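import Summits.QuantumFields.BalabanUV.Beta.EriceFlowEnclosureB12AsPrintedHistoryContagionShiftFlowRepinPicard
import Summits.QuantumFields.BalabanUV.Beta.EriceFlowEnclosureB12AsPrintedHistoryContagionShiftFlowPicardOpen

/-!
# Beta / EriceFlowEnclosureB12AsPrintedHistoryContagionShiftFlowRepinOpen — ASYMPTOTIC FREEDOM IS CONTAGIOUS, part 27: NEARBY FUNCTIONALS ARE WELL POSED AT THE PIN WHERE
# THEY ARE SOLVED — ONE THRESHOLD.  Part 19 (`exists_memFlow_of_close`) gave every functional B′ with a memory profile lying within η < β*∕4 of one admitting an AF reference a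
# box solution h′ of ITS OWN flow from every small pin e, asymptotically free at rate (β* − 4η)∕4 and scale 2e; its `existsUnique_memFlow_of_close` then had to descend to a
# SECOND, smaller pin e″ (`e″²∕e² ≲ ¾`), because part 10's uniqueness compares against a reference pinned strictly above.  With part 23's uniqueness AT the reference pin the
# descent disappears: h′ is B′'s reference AT e, so (§40) **`∃! h, SeqBox γ h ∧ MemFlow B′ e h` at the pin e itself** (`existsUnique_memFlow_of_close_samePin`), and (part 24)
# **node U2's `solution B′ e` IS that solution, the scale-wise limit of node U2's lattice-free `iterate B′ e`** (`memFlow_solution_of_close`) — node U2's complete §4 package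
# (`existsUnique_memFlow ∕ memFlow_solution ∕ eq_solution_of_memFlow ∕ tendsto_iterate`) for a functional of which NOTHING but a memory profile and sup-closeness to B is
# known, at ONE threshold in the pin.  Part 27's END (`…RepinOpenEnd`) reads it on the as-printed carrier: parts 20's g₁₃ and g₁₄ merge.
# Abstract in B, B′ (β-flow team, prover 1, unit `b2b-balaban-beta-bflow-p1`, gen 38; ROW AP-I·Uc × NODE U2)

HONEST FRAMING (page 1 of everything the β sub-cell writes): discharging `BetaPertH` makes Bałaban's UV stability UNCONDITIONAL — a
real constructive-QFT result; it is NOT the continuum limit and NOT the Clay problem.  HONEST DEPENDENCY (cell reorg 2026-08-19,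
verbatim): «continuum YM on T⁴ ⇐ BetaPertH ∧ nine spine estimates (0/9 proved); BetaPertH ⇐ (D1) ∧ (D4) ∧ CAP+tail; G-an2-4 gates
asym, D1 and NE2/3/4.»  THIS MODULE DISCHARGES NOTHING: it is BOOKKEEPING BY NAME (part 19's `exists_memFlow_of_close`, part 23's `existsUnique_memFlow_at_reference`, part 24's
`memFlow_solution_at_reference ∕ solution_eq_at_reference`; two rewrites of constants) over node U2's HYPOTHESIS SHAPES `T4BetaStationary.{SeqBox, MemoryProfile}`,
`T4BetaFlowWellPosed.{MemFlow, iterate, solution}` on ABSTRACT functionals `B, B′ : (ℕ → ℝ) → ℝ` — node U2's hypothesis shapes, which node U2 derives for Bałaban's limit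
functional from NE4 ∕ moduli LETTERS (NOT PRINTED for [I] = T. Bałaban, Commun. Math. Phys. **109** (1987) [Balaban1987RG1]: GAPS G-t4-U2-1 ∕ -2; the reference profile is
the shape of (0.31)'s lower half, Theorem 2 p. 259, STATED WITHOUT PROOF, in the continuum).  The η-closeness of B′ is a HYPOTHESIS about an abstract B′; nothing of Bałaban's β
is asserted; nothing of node U2's modules or of parts 1–26 is restated or modified.

WHAT THIS FILE PROVES (0 sorry, 0 def): §40 `reference_of_close`, **`existsUnique_memFlow_of_close_samePin`**, **`memFlow_solution_of_close`**.  NOT CLAIMED: anything about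
Bałaban's β; the carrier reading (`…RepinOpenEnd`); `BetaPertH`; the continuum limit of the measures; Clay.
-/

namespace Summit.QuantumFields.BalabanUV.Beta.EriceFlowEnclosureB12AsPrintedHistoryContagionShiftFlowRepinOpen

open Finset Filter Topology
open Literature.MathematicalPhysics.QuantumFieldTheory.Balaban1983to89
open Literature.MathematicalPhysics.QuantumFieldTheory.Balaban1983to89.T4BetaStationary (SeqBox MemoryProfile)
open Literature.MathematicalPhysics.QuantumFieldTheory.Balaban1983to89.T4BetaFlowWellPosed (MemFlow iterate solution)
open Summit.QuantumFields.BalabanUV.Beta.EriceFlowEnclosureB12AsPrintedHistoryContagionShiftFlowPicardOpen (exists_memFlow_of_close)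
open Summit.QuantumFields.BalabanUV.Beta.EriceFlowEnclosureB12AsPrintedHistoryContagionShiftFlowRepin (existsUnique_memFlow_at_reference memFlow_unique_at_reference)
open Summit.QuantumFields.BalabanUV.Beta.EriceFlowEnclosureB12AsPrintedHistoryContagionShiftFlowRepinPicard (memFlow_solution_at_reference solution_eq_at_reference)

noncomputable section

/-! ## §40 The perturbed functional is well posed at the pin where part 19 solved it -/

/-- **THE PERTURBED FUNCTIONAL'S OWN REFERENCE AT THE PIN e, WITH ITS SMALLNESS.**  `B` with memory profile `(C_m, θ)` on ]0, γ]^ℕ and ONE AF reference (t from g*, rate β*,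
scale t_a); `B′` with memory profile `(C_m, θ)` and `|B u − B′ u| ≤ η` for all box u, `4η < β*`; a pin `0 < e`, `4e ≤ γ`, below B's threshold (`4C_m e ≤ β*(1 − θ)`,
`e²·(1∕g*² + C_mγ∕(1 − θ)² + (2C_m∕((1 − θ)β*))²) ≤ 3∕4`, `64C_m e³ ≤ (1 − θ)²`) AND with `32C_m e ≤ (β* − 4η)(1 − θ)`, `4e²·(C_mγ∕(1 − θ)² + (8C_m∕((1 − θ)(β* − 4η)))²) ≤ ½`.
THEN B′ has a box solution h′ from e (part 19) which, read as B′'s reference with scale 2e and rate (β* − 4η)∕4, satisfies part 23's same-pin hypotheses `hr1`, `hr2`, and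
`2·(2e) ≤ γ`. [cite: Balaban1987RG1, Thm 2 (0.31) p.259 with (0.20) p.256 and p.298] -/
theorem reference_of_close {B B' : (ℕ → ℝ) → ℝ} {Cm θ γ bs ta gs e η : ℝ} {t : ℕ → ℝ}
    (hB : MemoryProfile Cm θ γ B) (hB' : MemoryProfile Cm θ γ B') (hCm : 0 ≤ Cm) (hθ0 : 0 ≤ θ) (hθ1 : θ < 1) (hbs : 0 < bs) (hta : 0 < ta)
    (hts : SeqBox γ t) (htf : MemFlow B gs t) (hprof : ∀ m : ℕ, 1 / ta ^ 2 + bs * (m : ℝ) ≤ 1 / (t m) ^ 2)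
    (hη : ∀ u, SeqBox γ u → |B u - B' u| ≤ η) (hη4 : 4 * η < bs)
    (he : 0 < e) (h4e : 4 * e ≤ γ)
    (hs1 : 4 * Cm * e ≤ bs * (1 - θ))
    (hs2 : e ^ 2 * (1 / gs ^ 2 + Cm * γ / (1 - θ) ^ 2 + (2 * Cm / ((1 - θ) * bs)) ^ 2) ≤ 3 / 4)
    (hs4 : 64 * Cm * e ^ 3 ≤ (1 - θ) ^ 2)
    (hp1 : 32 * Cm * e ≤ (bs - 4 * η) * (1 - θ))
    (hp2 : 4 * e ^ 2 * (Cm * γ / (1 - θ) ^ 2 + (8 * Cm / ((1 - θ) * (bs - 4 * η))) ^ 2) ≤ 1 / 2) :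
    ∃ h' : ℕ → ℝ, SeqBox γ h' ∧ MemFlow B' e h' ∧ (∀ m : ℕ, 1 / (2 * e) ^ 2 + (bs - 4 * η) / 4 * (m : ℝ) ≤ 1 / (h' m) ^ 2) ∧
      0 < (bs - 4 * η) / 4 ∧ 0 < 2 * e ∧ 2 * (2 * e) ≤ γ ∧ 4 * Cm * (2 * e) ≤ (bs - 4 * η) / 4 * (1 - θ) ∧
      (2 * e) ^ 2 * (Cm * γ / (1 - θ) ^ 2 + (2 * Cm / ((1 - θ) * ((bs - 4 * η) / 4))) ^ 2) ≤ 1 / 2 := by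
  have h1θ : 0 < 1 - θ := by linarith
  have h2e : 2 * e ≤ γ := by linarith
  have hus : SeqBox γ (fun _ : ℕ => e) := fun _ => ⟨he, by linarith⟩
  have henv : ∀ q : ℕ, (fun _ : ℕ => e) q ≤ 2 * e := fun _ => by simp only; linarith
  obtain ⟨h', hhs', hhf', hprof', -⟩ :=
    exists_memFlow_of_close hB hB' hCm hθ0 hθ1 hbs hta hts htf hprof hη hη4 he h2e hus henv hs1 hs2 hs4
  have hbη : 0 < bs - 4 * η := by linarith
  have hprof2 : ∀ m : ℕ, 1 / (2 * e) ^ 2 + (bs - 4 * η) / 4 * (m : ℝ) ≤ 1 / (h' m) ^ 2 := fun m => by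
    have e4 : 1 / (2 * e) ^ 2 = 1 / (4 * e ^ 2) := by ring
    rw [e4]; exact hprof' m
  have e8 : 2 * Cm / ((1 - θ) * ((bs - 4 * η) / 4)) = 8 * Cm / ((1 - θ) * (bs - 4 * η)) := by
    field_simp
    ring
  refine ⟨h', hhs', hhf', hprof2, by positivity, by positivity, by linarith, by linarith, ?_⟩
  rw [e8]
  calc (2 * e) ^ 2 * (Cm * γ / (1 - θ) ^ 2 + (8 * Cm / ((1 - θ) * (bs - 4 * η))) ^ 2)
      = 4 * e ^ 2 * (Cm * γ / (1 - θ) ^ 2 + (8 * Cm / ((1 - θ) * (bs - 4 * η))) ^ 2) := by ring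
    _ ≤ 1 / 2 := hp2

/-- **WELL-POSEDNESS OF THE PERTURBED FLOW AT THE PIN ITSELF — ONE THRESHOLD.**  Under the data of `reference_of_close` together with `128C_m e³ < (1 − θ)²`:
**`∃! h, SeqBox γ h ∧ MemFlow B′ e h`** — at the very pin e where part 19 produced a solution (part 19's `existsUnique_memFlow_of_close` needed a second pin e″ with
`e″²∕e² ≲ ¾`).  Part 23's `existsUnique_memFlow_at_reference` for B′ with its own solution as reference. [cite: Balaban1987RG1, Thm 2 (0.31) p.259 with (0.20) p.256 and p.298] -/
theorem existsUnique_memFlow_of_close_samePin {B B' : (ℕ → ℝ) → ℝ} {Cm θ γ bs ta gs e η : ℝ} {t : ℕ → ℝ}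
    (hB : MemoryProfile Cm θ γ B) (hB' : MemoryProfile Cm θ γ B') (hCm : 0 ≤ Cm) (hθ0 : 0 ≤ θ) (hθ1 : θ < 1) (hbs : 0 < bs) (hta : 0 < ta)
    (hts : SeqBox γ t) (htf : MemFlow B gs t) (hprof : ∀ m : ℕ, 1 / ta ^ 2 + bs * (m : ℝ) ≤ 1 / (t m) ^ 2)
    (hη : ∀ u, SeqBox γ u → |B u - B' u| ≤ η) (hη4 : 4 * η < bs)
    (he : 0 < e) (h4e : 4 * e ≤ γ)
    (hs1 : 4 * Cm * e ≤ bs * (1 - θ))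
    (hs2 : e ^ 2 * (1 / gs ^ 2 + Cm * γ / (1 - θ) ^ 2 + (2 * Cm / ((1 - θ) * bs)) ^ 2) ≤ 3 / 4)
    (hs4 : 64 * Cm * e ^ 3 ≤ (1 - θ) ^ 2)
    (hp1 : 32 * Cm * e ≤ (bs - 4 * η) * (1 - θ))
    (hp2 : 4 * e ^ 2 * (Cm * γ / (1 - θ) ^ 2 + (8 * Cm / ((1 - θ) * (bs - 4 * η))) ^ 2) ≤ 1 / 2)
    (hp4 : 128 * Cm * e ^ 3 < (1 - θ) ^ 2) : ∃! h : ℕ → ℝ, SeqBox γ h ∧ MemFlow B' e h := by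
  obtain ⟨h', hhs', hhf', hprof2, hb', h2e0, h4e', hr1, hr2⟩ :=
    reference_of_close hB hB' hCm hθ0 hθ1 hbs hta hts htf hprof hη hη4 he h4e hs1 hs2 hs4 hp1 hp2
  have hr4 : 16 * Cm * (2 * e) ^ 3 < (1 - θ) ^ 2 := by nlinarith
  exact existsUnique_memFlow_at_reference hB' hCm hθ0 hθ1 hb' h2e0 hhs' hhf' hprof2 hr1 hr2 hr4

/-- **NODE U2's `solution B′ e` IS THE PERTURBED FLOW's UNIQUE BOX SOLUTION, COMPUTED BY NODE U2's LATTICE-FREE ITERATION — AT THE PIN ITSELF.**  Under the data of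
`reference_of_close` together with `512C_m e³ ≤ (1 − θ)²`: `solution B′ e` is box-valued, solves `MemFlow B′ e ·`, carries the profile `1∕(4e²) + ((β* − 4η)∕4)m`, is the
scale-wise limit of node U2's `iterate B′ e`, and EVERY box solution of B′'s flow from e equals it — node U2's `memFlow_solution ∕ eq_solution_of_memFlow ∕ tendsto_iterate`
for a functional of which nothing but a memory profile and sup-closeness to B is known, with NO floor and ONE threshold (parts 24 + 23 with B′'s own solution as reference).
[cite: Balaban1987RG1, Thm 2 (0.31) p.259 with (0.20) p.256 and p.298] -/
theorem memFlow_solution_of_close {B B' : (ℕ → ℝ) → ℝ} {Cm θ γ bs ta gs e η : ℝ} {t : ℕ → ℝ}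
    (hB : MemoryProfile Cm θ γ B) (hB' : MemoryProfile Cm θ γ B') (hCm : 0 ≤ Cm) (hθ0 : 0 ≤ θ) (hθ1 : θ < 1) (hbs : 0 < bs) (hta : 0 < ta)
    (hts : SeqBox γ t) (htf : MemFlow B gs t) (hprof : ∀ m : ℕ, 1 / ta ^ 2 + bs * (m : ℝ) ≤ 1 / (t m) ^ 2)
    (hη : ∀ u, SeqBox γ u → |B u - B' u| ≤ η) (hη4 : 4 * η < bs)
    (he : 0 < e) (h4e : 4 * e ≤ γ)
    (hs1 : 4 * Cm * e ≤ bs * (1 - θ))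
    (hs2 : e ^ 2 * (1 / gs ^ 2 + Cm * γ / (1 - θ) ^ 2 + (2 * Cm / ((1 - θ) * bs)) ^ 2) ≤ 3 / 4)
    (hs4 : 64 * Cm * e ^ 3 ≤ (1 - θ) ^ 2)
    (hp1 : 32 * Cm * e ≤ (bs - 4 * η) * (1 - θ))
    (hp2 : 4 * e ^ 2 * (Cm * γ / (1 - θ) ^ 2 + (8 * Cm / ((1 - θ) * (bs - 4 * η))) ^ 2) ≤ 1 / 2)
    (hp4 : 512 * Cm * e ^ 3 ≤ (1 - θ) ^ 2) :
    SeqBox γ (solution B' e) ∧ MemFlow B' e (solution B' e) ∧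
      (∀ m : ℕ, 1 / (4 * e ^ 2) + (bs - 4 * η) / 4 * (m : ℝ) ≤ 1 / (solution B' e m) ^ 2) ∧
      (∀ m, Tendsto (fun n => iterate B' e n m) atTop (𝓝 (solution B' e m))) ∧
      ∀ h : ℕ → ℝ, SeqBox γ h → MemFlow B' e h → h = solution B' e := by
  have h1θ : 0 < 1 - θ := by linarith
  obtain ⟨h', hhs', hhf', hprof2, hb', h2e0, h4e', hr1, hr2⟩ :=
    reference_of_close hB hB' hCm hθ0 hθ1 hbs hta hts htf hprof hη hη4 he h4e hs1 hs2 hs4 hp1 hp2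
  have hr4 : 64 * Cm * (2 * e) ^ 3 ≤ (1 - θ) ^ 2 := by nlinarith
  have hr4' : 16 * Cm * (2 * e) ^ 3 < (1 - θ) ^ 2 := by
    have : 0 < (1 - θ) ^ 2 := by positivity
    nlinarith [mul_nonneg hCm (pow_nonneg h2e0.le 3)]
  have hsol : solution B' e = h' := solution_eq_at_reference hB' hCm hθ0 hθ1 hb' h2e0 hhs' hhf' hprof2 h4e' hr1 hr2 hr4
  obtain ⟨-, -, -, hlim, -⟩ := memFlow_solution_at_reference hB' hCm hθ0 hθ1 hb' h2e0 hhs' hhf' hprof2 h4e' hr1 hr2 hr4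
  have hprofs : ∀ m : ℕ, 1 / (4 * e ^ 2) + (bs - 4 * η) / 4 * (m : ℝ) ≤ 1 / (solution B' e m) ^ 2 := fun m => by
    have e4 : 1 / (4 * e ^ 2) = 1 / (2 * e) ^ 2 := by ring
    rw [hsol, e4]; exact hprof2 m
  refine ⟨hsol ▸ hhs', hsol ▸ hhf', hprofs, hlim, fun h hh hf => ?_⟩
  rw [hsol]
  exact memFlow_unique_at_reference hB' hCm hθ0 hθ1 hb' h2e0 hhs' hhf' hprof2 hh hf hr1 hr2 hr4'

end

end Summit.QuantumFields.BalabanUV.Beta.EriceFlowEnclosureB12AsPrintedHistoryContagionShiftFlowRepinOpen
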